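import Mathlib
import HarnessLib
import Summits.QuantumFields.YangMills.Theses.PencilRigidity
import Summits.QuantumFields.YangMills.Theorems.PencilRigidityCurvatureKernelBoundAxisEnvelope
import Summits.QuantumFields.YangMills.Theorems.PencilRigidityCurvatureKernelBoundKernelPinning
import Summits.QuantumFields.YangMills.Theorems.PencilRigidityCurvatureKernelBoundPartitionBump
import Summits.QuantumFields.YangMills.Theorems.PencilRigidityCurvatureKernelBoundLocalRepresentation
import Summits.QuantumFields.YangMills.Theorems.PencilRigidityCurvatureKernelBoundKernelExistence
import Summits.QuantumFields.YangMills.Theorems.PencilRigidityCurvatureKernelBoundHalfSpaceKernel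
import Summits.QuantumFields.YangMills.Theorems.PencilRigidityCurvatureKernelBoundKernelExistenceOfLocalDecay
import Summits.QuantumFields.YangMills.Theorems.PencilRigidityCurvatureKernelBoundAxialGrowthOfLocalDecayDatum
import Summits.QuantumFields.YangMills.Theorems.PencilRigidityCurvatureKernelBoundSmearedToLocalDecay

/-!
# `CurvatureKernelBound` — the kernel conclusion for ONE witness from its two-point local decay / its smeared lattice window bound (support for stmt-QuantumFields-11687)

Crux `stmt-QuantumFields-11687` (`PencilRigidity.CurvatureKernelBound`), line `sixteen-charts-analytic-kernel`, skeleton v16 —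
the EXISTENCE-LEG FOLDS in the two currencies of the c5 reshaping (registered stubs `KernelConclusionOfWitnessLocalDecay`
and `KernelConclusionOfWitnessSmeared`). For ONE datum `(G, r, sch, S₁)` carrying the curvature package `W₁`:

* `KernelConclusionOfWitnessLocalDecay` (T currency): the TWO-POINT LOCAL DECAY of `S₁` — for `0 < s < s₁` local bounds
  `‖S₁ 2 (f 0 ⊗ f 1)‖ ≤ A ‖f 0‖₁ ‖f 1‖₁ + B r⁸ ‖f 0‖∞ ‖f 1‖∞` on real tensors supported in `r`-balls (`r ≤ r₀(s)`) about
  `∓s e₀`, with `A + B ≤ C s^(η−10)` — gives the conclusion of the crux for `S₁`: a real kernel continuous off `0`,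
  `|K x| ≤ C (1 + ‖x‖^(η−10))`, representing `S₁ 2` on `⁰𝒮`;
* `KernelConclusionOfWitnessSmeared` (E^sm currency): the SMEARED LATTICE WINDOW BOUND of the scheme `(r, sch)` (frequently in
  `k`, `|LS₂ − LS₁ LS₁| ≤ C s^(η−10) R_k(f 0) R_k(f 1)` for real test functions in the balls `B̄(∓s e₀, ρ)`, `ρ ≤ s/2`,
  `a_k R₀ ≤ s ≤ θ`) gives the same conclusion, via the landed `SmearedToLocalDecay` (`W₁ + E^sm ⇒` local decay).

Proof of the first (exactly the proof of the landed `KernelConclusionOfWitnessLatticeDFree`, with the lattice inputs replaced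
by the local decay): the complex representing kernel from `KernelExistence (HalfSpaceKernel PartitionBump) LocalRepresentation`
fed with the polynomially controlled local bounds (`s₁' = min s₁ 1`, `A₀ = max C 0`, `p₀ = 10`, as in
`KernelExistenceOfLocalDecay`); reality from `LatticeReality` (the two-point function is a limit of real lattice
correlations on real off-diagonal tensors); the envelope from `AxisEnvelope`; the UV datum `‖K(s e₀)‖ ≤ C s^(η−10)` on
`(0,1]` from the per-datum axial growth `AxialGrowthOfLocalDecayDatum`; assembly of the real kernel `Re K` verbatim.
These are the statements a planner folds into the existence leg (`HypercubicLimit` witness + its two-point local decay /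
its smeared lattice window bound ⇒ everything the route's `closes` takes from `CurvatureKernelBound` for that witness). [folklore]
-/

noncomputable section

open scoped BigOperators Topology
open MeasureTheory Filter Set
open Literature.MathematicalPhysics.QuantumLattice Literature.MathematicalPhysics.AQFT
open Literature.MathematicalPhysics.QuantumFieldTheory

namespace Summit.QuantumFields.YangMills.Theorems.CurvatureKernel

open KernelExistenceOfLocalDecayAux in
/-- **`KernelConclusionOfWitnessLocalDecay`** (registered stub of stmt-QuantumFields-11687, line `sixteen-charts-analytic-kernel`).
For one datum `(G, r, sch, S₁)` with the curvature package `W₁` and the two-point local decay of `S₁` (constants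
`A + B ≤ C s^(η−10)` on `0 < s < s₁`), the conclusion of `CurvatureKernelBound` holds for `S₁`: a real kernel continuous off `0`,
`|K x| ≤ C (1 + ‖x‖^(η−10))`, representing `S₁ 2` on `⁰𝒮`. See the module docstring. [folklore] -/
theorem KernelConclusionOfWitnessLocalDecay : open Literature.MathematicalPhysics.QuantumLattice Literature.MathematicalPhysics.AQFT Literature.MathematicalPhysics.QuantumFieldTheory in ∀ (G : Type) [Group G] [TopologicalSpace G] [IsTopologicalGroup G] [CompactSpace G] [MeasurableSpace G] [BorelSpace G], IsCompactSimpleLieGroup G → ∀ (r : LatticeRep G) (sch : SpeciesScheme (YMSpecies G)) (S₁ : SchwingerFamily (EuclideanSpace ℝ (Fin 4))), ((∀ (n : ℕ), n ≠ 0 → ∀ (f : Fin n → SchwartzMap (EuclideanSpace ℝ (Fin 4)) ℝ) (F : SchwartzMap (Fin n → (EuclideanSpace ℝ (Fin 4))) ℂ), IsTensorOf F (fun i => ofRealTest (f i)) → IsOffDiagonal F → Filter.Tendsto (fun k : ℕ => ((latticeSchwinger r.ρ sch (fun s => s.F) k n (fun _ => r.curvature) f : ℝ) : ℂ)) Filter.atTop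 (nhds (S₁ n F))) ∧ (S₁.toLabelled.IsNormalized ∧ S₁.toLabelled.IsHermitian ∧ S₁.toLabelled.HasLinearGrowth ∧ S₁.toLabelled.IsReflectionPositive ∧ S₁.toLabelled.IsSymmetric ∧ S₁.toLabelled.HasClusterProperty) ∧ (∀ (n : ℕ) (a : (EuclideanSpace ℝ (Fin 4))) (F : SchwartzMap (Fin n → (EuclideanSpace ℝ (Fin 4))) ℂ), IsOffDiagonal F → S₁ n (translateMulti a F) = S₁ n F) ∧ (∀ (R : (EuclideanSpace ℝ (Fin 4)) ≃ₗᵢ[ℝ] (EuclideanSpace ℝ (Fin 4))), LinearMap.det (R.toLinearEquiv : (EuclideanSpace ℝ (Fin 4)) →ₗ[ℝ] (EuclideanSpace ℝ (Fin 4))) = 1 → (∀ i : Fin 4, ∃ j : Fin 4, R (EuclideanSpace.single i 1) = EuclideanSpace.single j 1 ∨ R (EuclideanSpace.single i 1) = -EuclideanSpace.single j 1) → ∀ (n : ℕ) (F : SchwartzMap (Fin n → (EuclideanSpace ℝ (Fin 4))) ℂ), IsOffDiagonal F → S₁ n (linActMulti R F) = S₁ n F) ∧ (∃ Δ : ℝ,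 0 < Δ ∧ S₁.toLabelled.HasMassGap Δ ∧ HasLatticeMassGap r sch Δ)) → (∃ (C η s₁ : ℝ), 0 < η ∧ 0 < s₁ ∧ (∀ (s : ℝ), 0 < s → s < s₁ → ∃ (r₀ A B : ℝ), 0 < r₀ ∧ 0 ≤ A ∧ 0 ≤ B ∧ A + B ≤ C * s ^ (η - 10) ∧ (∀ (r : ℝ), 0 < r → r ≤ r₀ → ∀ (f : Fin 2 → SchwartzMap (EuclideanSpace ℝ (Fin 4)) ℝ) (F : SchwartzMap (Fin 2 → (EuclideanSpace ℝ (Fin 4))) ℂ) (M₀ M₁ : ℝ), IsTensorOf F (fun i => ofRealTest (f i)) → tsupport ((f 0 : SchwartzMap (EuclideanSpace ℝ (Fin 4)) ℝ) : (EuclideanSpace ℝ (Fin 4)) → ℝ) ⊆ Metric.closedBall (EuclideanSpace.single (0 : Fin 4) (-s)) r → tsupport ((f 1 : SchwartzMap (EuclideanSpace ℝ (Fin 4)) ℝ) : (EuclideanSpace ℝ (Fin 4)) → ℝ) ⊆ Metric.closedBall (EuclideanSpace.single (0 : Fin 4) s) r → (∀ x, |f 0 x| ≤ M₀) → (∀ x,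 |f 1 x| ≤ M₁) → ‖S₁ 2 F‖ ≤ A * (∫ x : (EuclideanSpace ℝ (Fin 4)), |f 0 x|) * (∫ x : (EuclideanSpace ℝ (Fin 4)), |f 1 x|) + B * r ^ 8 * M₀ * M₁))) → ∃ (K : (EuclideanSpace ℝ (Fin 4)) → ℝ) (C η : ℝ), 0 < η ∧ ContinuousOn K {x : (EuclideanSpace ℝ (Fin 4)) | x ≠ 0} ∧ (∀ x : (EuclideanSpace ℝ (Fin 4)), x ≠ 0 → |K x| ≤ C * (1 + ‖x‖ ^ (η - 10))) ∧ ∀ F : SchwartzMap (Fin 2 → (EuclideanSpace ℝ (Fin 4))) ℂ, IsOffDiagonal F → MeasureTheory.Integrable (fun x : Fin 2 → (EuclideanSpace ℝ (Fin 4)) => (K (x 0 - x 1) : ℂ) * F x) ∧ S₁ 2 F = ∫ x : Fin 2 → (EuclideanSpace ℝ (Fin 4)), (K (x 0 - x 1) : ℂ) * F x := by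
  -- adapted from `KernelConclusionOfWitnessLatticeDFree` (lattice inputs replaced by the two-point local decay)
  intro G _ _ _ _ _ _ hG r sch S₁ hW₁ hDC
  obtain ⟨hconv, hpkg, htr, hhyp, hgap⟩ := hW₁
  -- the local decay is polynomially controlled: `C s^(η−10) ≤ max C 0 · (1 + s⁻¹ ^ 10)` on `0 < s < min s₁ 1`
  have hLBF : ∃ (s₁ A₀ : ℝ) (p₀ : ℕ), 0 < s₁ ∧ 0 ≤ A₀ ∧ (∀ (s : ℝ), 0 < s → s < s₁ → ∃ (r₀ A B : ℝ), 0 < r₀ ∧ 0 ≤ A ∧ 0 ≤ B ∧ A + B ≤ A₀ * (1 + s⁻¹ ^ p₀) ∧ (∀ (r : ℝ), 0 < r → r ≤ r₀ → ∀ (f : Fin 2 → SchwartzMap (EuclideanSpace ℝ (Fin 4)) ℝ) (F : SchwartzMap (Fin 2 → (EuclideanSpace ℝ (Fin 4))) ℂ) (M₀ M₁ : ℝ), IsTensorOf F (fun i => ofRealTest (f i)) → tsupport ((f 0 : SchwartzMap (EuclideanSpace ℝ (Fin 4)) ℝ) : (EuclideanSpace ℝ (Fin 4)) → ℝ) ⊆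 Metric.closedBall (EuclideanSpace.single (0 : Fin 4) (-s)) r → tsupport ((f 1 : SchwartzMap (EuclideanSpace ℝ (Fin 4)) ℝ) : (EuclideanSpace ℝ (Fin 4)) → ℝ) ⊆ Metric.closedBall (EuclideanSpace.single (0 : Fin 4) s) r → (∀ x, |f 0 x| ≤ M₀) → (∀ x, |f 1 x| ≤ M₁) → ‖S₁ 2 F‖ ≤ A * (∫ x : (EuclideanSpace ℝ (Fin 4)), |f 0 x|) * (∫ x : (EuclideanSpace ℝ (Fin 4)), |f 1 x|) + B * r ^ 8 * M₀ * M₁)) := by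
    -- adapted from `KernelExistenceOfLocalDecay`
    obtain ⟨C, η, s₁, hη, hs₁, hdec⟩ := hDC
    refine ⟨min s₁ 1, max C 0, 10, lt_min hs₁ one_pos, le_max_right _ _, ?_⟩
    intro s hs hs'
    obtain ⟨r₀, A, B, hr₀, hA, hB, hAB, hLB⟩ := hdec s hs (lt_of_lt_of_le hs' (min_le_left _ _))
    exact ⟨r₀, A, B, hr₀, hA, hB,
      le_max_mul_one_add_inv_pow hη hs (hs'.le.trans (min_le_right _ _)) hAB, hLB⟩
  -- (A) the complex kernel, continuous off 0, representing S₁ 2 on ⁰𝒮: local bounds + half-space kernel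
  obtain ⟨K, hcont, hrep⟩ := KernelExistence (HalfSpaceKernel PartitionBump) LocalRepresentation S₁ hpkg.2.2.2.1 htr hhyp
    hLBF
  -- reality of S₁ 2 on real off-diagonal tensors: a limit of real lattice correlations
  have hrealS : ∀ (f : Fin 2 → SchwartzMap (EuclideanSpace ℝ (Fin 4)) ℝ)
      (F : SchwartzMap (Fin 2 → EuclideanSpace ℝ (Fin 4)) ℂ),
      IsTensorOf F (fun i => ofRealTest (f i)) → IsOffDiagonal F → (S₁ 2 F).im = 0 := by
    intro f F hF hoff
    have ht := hconv 2 (by norm_num) f F hF hoff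
    have hc := (Complex.continuous_im.tendsto _).comp ht
    have h0 : Filter.Tendsto (fun _ : ℕ => (0 : ℝ)) Filter.atTop (nhds (S₁ 2 F).im) :=
      hc.congr (fun k => by simp)
    exact (tendsto_const_nhds_iff.mp h0).symm
  -- (C) the kernel is real off 0
  have him : ∀ x, x ≠ 0 → (K x).im = 0 := LatticeReality S₁ K hcont hrep hrealS
  -- (B) the axial envelope (axis reflection positivity only)
  obtain ⟨hpos, hmono, henv⟩ := AxisEnvelope S₁ K hpkg.2.2.2.1 htr hhyp hcont hrep
  -- (E) the UV datum: growth of k(s) = K(s e₀) on (0, 1], from the per-datum axial growth of the local decay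
  obtain ⟨C, η, hη, hax⟩ :=
    AxialGrowthOfLocalDecayDatum G hG r sch S₁ ⟨hconv, hpkg, htr, hhyp, hgap⟩ hDC K hcont hrep
  -- constants
  set k₀ : ℝ := (K (EuclideanSpace.single 0 (1 / 2 : ℝ))).re with hk₀
  have hk₀nn : 0 ≤ k₀ := (hpos (1 / 2) (by norm_num)).2
  have h2pos : (0 : ℝ) < 2 ^ (η - 10) := Real.rpow_pos_of_pos (by norm_num) _
  set C₁ : ℝ := |C| / 2 ^ (η - 10) with hC₁
  have hC₁nn : 0 ≤ C₁ := div_nonneg (abs_nonneg C) h2pos.le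
  refine ⟨fun x => (K x).re, k₀ + C₁, η, hη, ?_, ?_, ?_⟩
  · -- continuity off 0
    exact Complex.continuous_re.comp_continuousOn hcont
  · -- the bound |K_real x| ≤ (k₀ + C₁) (1 + ‖x‖^(η-10))
    intro x hx
    have htpos : 0 < ‖x‖ := norm_pos_iff.mpr hx
    have hrnn : 0 ≤ ‖x‖ ^ (η - 10) := Real.rpow_nonneg htpos.le _
    have h1 : |(K x).re| ≤ (K (EuclideanSpace.single 0 (‖x‖ / 2))).re :=
      (Complex.abs_re_le_norm _).trans (henv x hx)
    by_cases hle : ‖x‖ ≤ 1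
    · have h2 : (K (EuclideanSpace.single 0 (‖x‖ / 2))).re ≤ C * (‖x‖ / 2) ^ (η - 10) :=
        (Complex.re_le_norm _).trans (hax (‖x‖ / 2) (half_pos htpos) (by linarith))
      have h3 : C * (‖x‖ / 2) ^ (η - 10) ≤ C₁ * ‖x‖ ^ (η - 10) := by
        rw [Real.div_rpow htpos.le zero_le_two, hC₁]
        calc C * (‖x‖ ^ (η - 10) / 2 ^ (η - 10))
            ≤ |C| * (‖x‖ ^ (η - 10) / 2 ^ (η - 10)) :=
              mul_le_mul_of_nonneg_right (le_abs_self C) (div_nonneg hrnn h2pos.le)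
          _ = |C| / 2 ^ (η - 10) * ‖x‖ ^ (η - 10) := by ring
      calc |(K x).re| ≤ C₁ * ‖x‖ ^ (η - 10) := h1.trans (h2.trans h3)
        _ ≤ (k₀ + C₁) * ‖x‖ ^ (η - 10) := by nlinarith [hk₀nn, hrnn]
        _ ≤ (k₀ + C₁) * (1 + ‖x‖ ^ (η - 10)) := by nlinarith [hk₀nn, hC₁nn, hrnn]
    · have hlt : 1 < ‖x‖ := lt_of_not_ge hle
      have h2 : (K (EuclideanSpace.single 0 (‖x‖ / 2))).re ≤ k₀ :=
        hmono (Set.mem_Ioi.mpr (by norm_num : (0 : ℝ) < 1 / 2)) (Set.mem_Ioi.mpr (half_pos htpos))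
          (by linarith)
      calc |(K x).re| ≤ k₀ := h1.trans h2
        _ ≤ (k₀ + C₁) * 1 := by linarith [hC₁nn]
        _ ≤ (k₀ + C₁) * (1 + ‖x‖ ^ (η - 10)) := by nlinarith [hk₀nn, hC₁nn, hrnn]
  · -- the representation on ⁰𝒮 with the real kernel: the integrands coincide pointwise
    intro F hF
    have hfun : (fun y : Fin 2 → EuclideanSpace ℝ (Fin 4) => (((K (y 0 - y 1)).re : ℝ) : ℂ) * F y) =
        fun y => K (y 0 - y 1) * F y := by
      funext y
      by_cases h : y 0 = y 1
      · have hy : y ∈ coincidenceLocus 2 (EuclideanSpace ℝ (Fin 4)) :=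
          (mem_coincidenceLocus y).mpr ⟨0, 1, by decide, h⟩
        simp [hF.apply_eq_zero hy]
      · have hne : y 0 - y 1 ≠ 0 := sub_ne_zero.mpr h
        congr 1
        exact Complex.ext (by simp) (by simp [him _ hne])
    obtain ⟨hint, hSF⟩ := hrep F hF
    refine ⟨?_, ?_⟩
    · rw [hfun]; exact hint
    · rw [hfun]; exact hSF

/-- **`KernelConclusionOfWitnessSmeared`** (registered stub of stmt-QuantumFields-11687, line `sixteen-charts-analytic-kernel`).
For one datum `(G, r, sch, S₁)` with the curvature package `W₁` and the smeared lattice window bound of `(r, sch)` (frequently in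
`k`: `|LS₂ − LS₁ LS₁| ≤ C s^(η−10) R_k(f 0) R_k(f 1)` for real test functions supported in `B̄(∓s e₀, ρ)`, `ρ ≤ s/2`,
`a_k R₀ ≤ s ≤ θ`), the conclusion of `CurvatureKernelBound` holds for `S₁`: `SmearedToLocalDecay` then
`KernelConclusionOfWitnessLocalDecay`. [folklore] -/
theorem KernelConclusionOfWitnessSmeared : open Literature.MathematicalPhysics.QuantumLattice Literature.MathematicalPhysics.AQFT Literature.MathematicalPhysics.QuantumFieldTheory in ∀ (G : Type) [Group G] [TopologicalSpace G] [IsTopologicalGroup G] [CompactSpace G] [MeasurableSpace G] [BorelSpace G], IsCompactSimpleLieGroup G → ∀ (r : LatticeRep G) (sch : SpeciesScheme (YMSpecies G)) (S₁ : SchwingerFamily (EuclideanSpace ℝ (Fin 4))), ((∀ (n : ℕ), n ≠ 0 → ∀ (f : Fin n → SchwartzMap (EuclideanSpace ℝ (Fin 4)) ℝ) (F : SchwartzMap (Fin n → (EuclideanSpace ℝ (Fin 4))) ℂ), IsTensorOf F (fun i => ofRealTest (f i)) → IsOffDiagonal F → Filter.Tendsto (fun k : ℕ => ((latticeSchwinger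 r.ρ sch (fun s => s.F) k n (fun _ => r.curvature) f : ℝ) : ℂ)) Filter.atTop (nhds (S₁ n F))) ∧ (S₁.toLabelled.IsNormalized ∧ S₁.toLabelled.IsHermitian ∧ S₁.toLabelled.HasLinearGrowth ∧ S₁.toLabelled.IsReflectionPositive ∧ S₁.toLabelled.IsSymmetric ∧ S₁.toLabelled.HasClusterProperty) ∧ (∀ (n : ℕ) (a : (EuclideanSpace ℝ (Fin 4))) (F : SchwartzMap (Fin n → (EuclideanSpace ℝ (Fin 4))) ℂ), IsOffDiagonal F → S₁ n (translateMulti a F) = S₁ n F) ∧ (∀ (R : (EuclideanSpace ℝ (Fin 4)) ≃ₗᵢ[ℝ] (EuclideanSpace ℝ (Fin 4))), LinearMap.det (R.toLinearEquiv : (EuclideanSpace ℝ (Fin 4)) →ₗ[ℝ] (EuclideanSpace ℝ (Fin 4))) = 1 → (∀ i : Fin 4, ∃ j : Fin 4, R (EuclideanSpace.single i 1) = EuclideanSpace.single j 1 ∨ R (EuclideanSpace.single i 1) = -EuclideanSpace.single j 1) → ∀ (n : ℕ) (F : SchwartzMap (Fin n → (EuclideanSpace ℝ (Fin 4))) ℂ),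 IsOffDiagonal F → S₁ n (linActMulti R F) = S₁ n F) ∧ (∃ Δ : ℝ, 0 < Δ ∧ S₁.toLabelled.HasMassGap Δ ∧ HasLatticeMassGap r sch Δ)) → (∃ (C η θ R₀ : ℝ), 0 < η ∧ 0 < θ ∧ ∃ᶠ k in Filter.atTop, ∀ (s ρ : ℝ), 0 < s → sch.a k * R₀ ≤ s → s ≤ θ → 0 < ρ → ρ ≤ s / 2 → ∀ (f : Fin 2 → SchwartzMap (EuclideanSpace ℝ (Fin 4)) ℝ), tsupport ((f 0 : SchwartzMap (EuclideanSpace ℝ (Fin 4)) ℝ) : (EuclideanSpace ℝ (Fin 4)) → ℝ) ⊆ Metric.closedBall (EuclideanSpace.single (0 : Fin 4) (-s)) ρ → tsupport ((f 1 : SchwartzMap (EuclideanSpace ℝ (Fin 4)) ℝ) : (EuclideanSpace ℝ (Fin 4)) → ℝ) ⊆ Metric.closedBall (EuclideanSpace.single (0 : Fin 4) s) ρ → |latticeSchwinger r.ρ sch (fun s => s.F) k 2 (fun _ => r.curvature) f - latticeSchwinger r.ρ sch (fun s => s.F) k 1 (fun _ => r.curvature) (fun _ => f 0) * latticeSchwinger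 r.ρ sch (fun s => s.F) k 1 (fun _ => r.curvature) (fun _ => f 1)| ≤ C * s ^ (η - 10) * ((sch.a k) ^ 4 * ∑ x ∈ Literature.Probability.LatticeModels.box 4 (sch.L k), |f 0 (sch.a k • siteToE x)|) * ((sch.a k) ^ 4 * ∑ x ∈ Literature.Probability.LatticeModels.box 4 (sch.L k), |f 1 (sch.a k • siteToE x)|)) → ∃ (K : (EuclideanSpace ℝ (Fin 4)) → ℝ) (C η : ℝ), 0 < η ∧ ContinuousOn K {x : (EuclideanSpace ℝ (Fin 4)) | x ≠ 0} ∧ (∀ x : (EuclideanSpace ℝ (Fin 4)), x ≠ 0 → |K x| ≤ C * (1 + ‖x‖ ^ (η - 10))) ∧ ∀ F : SchwartzMap (Fin 2 → (EuclideanSpace ℝ (Fin 4))) ℂ, IsOffDiagonal F → MeasureTheory.Integrable (fun x : Fin 2 → (EuclideanSpace ℝ (Fin 4)) => (K (x 0 - x 1) : ℂ) * F x) ∧ S₁ 2 F = ∫ x : Fin 2 → (EuclideanSpace ℝ (Fin 4)), (K (x 0 - x 1) : ℂ) * F x := by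
  intro G _ _ _ _ _ _ hG r sch S₁ hW₁ hSWB
  exact KernelConclusionOfWitnessLocalDecay G hG r sch S₁ hW₁ (SmearedToLocalDecay G hG r sch S₁ hW₁ hSWB)

end Summit.QuantumFields.YangMills.Theorems.CurvatureKernel

end
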